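import Summits.ResolutionOfSingularities.ResolutionOfSingularities.Theorems.EquisingularLiftEquisingularLiftNatResidueHypDefs9
import Literature.AlgebraicGeometry.HodgeTheory.NormalSheafAffineSections
import HarnessLib

/-!
# [OURS · L1 W4.5(b) · EL♮ / EL♮(3)] RESIDUE HYPOTHESIS DEFS 10 — the «NODAL HOSTED ROUND» ISO blob (WIDTH TABLE D8; desk R69):
# `PrefixReachKeyLetterParam8` (= Defs9's `PrefixReachKeyLetterParam7` with the hosted-round clause (HR-KEEP) REPLACED by ONE clause (HR-KEEP-N), every other clause and END
# byte-equal), its instance `PrefixReachKeyLetterP8`, the blob `IsoHypReachNDLeavesP8`, and the PURE inclusions from P7 / P6 / P5 / P + the REPLACE lemma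

PEN (desk R69 (iii)): res-type-027 g22.  OURS; NAMED HYPOTHESES, not statements of any manuscript; nothing of [Hironaka2017] asserted; AI-written, weaker than expert
review; resolution of singularities in positive characteristic is NOT proved here, EL♮(3) is NOT proved here.  `--kind definition --supports stmt-ResolutionOfSingularities-20148 --as helper`.

THE ONE CHANGE vs Defs9 (✓ p683422's `PrefixReachKeyLetterParam7`): clause (HR-KEEP) «hosted round in a listed host `E₁` that keeps its members» (binders: `E₁ ∈ Ls`,
`Z ⊆ closure E₁`, `Z ⊆ T₁`, `¬ T₁ ⊆ Z`, «`Z̃` regular», «`Ẽ₁` regular along `Z̃`», `DirStepUnobs F₁ (closure E₁) _ Z hZ`, curve clause, members block, `IsBlowup υ' 𝓘⟨Z⟩`)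
becomes clause **(HR-KEEP-N)** «NODAL hosted round that keeps its members»: binder 5 «`∀ z : Z̃, IsRegularLocalRing (stalk z)`» is REPLACED by
**(N1)** `Set.Finite {z : Z̃ | ¬ IsRegularLocalRing (stalk z)}` (the tower carrier round's own wording, `ReachTowerBTriplePrime`), and ONE binder is ADDED after
`DirStepUnobs`: **(N4)** «for the closed immersion `i : Z̃ ⟶ Ẽ₁` there is a GLOBAL section `ψ ∈ Γ(Z̃, 𝒩_{Z̃/Ẽ₁})` (tree `HodgeTheory.normalSheaf i`) such that at
every non-regular closed point `z` of `Z̃`, on some affine chart `U ∋ i z` of `Ẽ₁` and some local section `m ∈ Γ(U, 𝓘)` of the ideal of `Z̃`, the value `ψ(m)`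
(tree `normalSectionsVal`) is a UNIT at `z`» — i.e. `ψ(z) ≠ 0` (`𝓘_z` is principal: `Z̃` is Cartier in the regular surface `Ẽ₁`, so `𝒩` is invertible).  (N2) =
«`Ẽ₁` regular along `Z̃`» (every singularity of `Z̃` is PLANAR) and (N3) = `DirStepUnobs` (`H¹(Z̃, 𝒩) = 0`, Čech) are byte-identical, and so are the curve clause, the
members block, the blow-up and the ONE output `Q F₃ (υ' ≫ ρ) (closure (υ'⁻¹(T₁ ∖ Z))) (Ls.map St ++ [υ'⁻¹ Z]) none`.
WHY (lead-1 FORCED-MULTISECTION-Q47 memo v1.2 44bbf127ca63d9cd; panel CONCUR ×2; idea-2 NU6-SIZING v1 f7350c7bfe4bdd6c): the certified customer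
Q47 := V₊(D² + x⁹ + x¹⁸ + y¹⁸ + z¹⁸) ∉ `IsoHypReachNDLeavesP7` forces a hosted round at the rational NODAL 4-section Γ₀ ⊂ E_ℓ ≅ 𝔽₂ (9 ordinary nodes); UPSTAIRS the
centre `𝒵 = V(ỹ, d + ϖd′)` is REGULAR and `O`-flat with reduced trace Γ₀ (the nodes are smoothed: `uv + ϖ·unit ∉ 𝔪²`), so the ENGINE clause is discharged by
✓ `TCPlus.hround_keep` AS IS and (N1)–(N4) are purely LIFT-EXISTENCE input ((N3): formal lifts to all orders; (N4): regular total space at the nodes); the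
construction of the lift from (N1)–(N4) is the support debt S-D8-LIFT (a conjunct of K5⁸'s `hres`), not a registration gate.
PURE LOGIC: a motive closed under (HR-KEEP-N) is closed under (HR-KEEP) — with `Z̃` regular the non-regular set is empty ((N1) by `Set.finite_empty`) and (N4) is
vacuous (`ψ := 0`) — hence `prefixReachKeyLetterParam8_of_param7`, `prefixReachKeyLetterP8_of_P7`, the blob inclusions ★ `isoHypReachNDLeavesP8_of_P7` / `_of_P6` /
`_of_P5` / `_of_P`, and the REPLACE lemma `not_isoHypReachNDLeavesP7_of_not_P8` (vs the REGISTERED hypothesis of `stub_elnat_three_isolated_nonNDLeaves7`): the cut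
`¬ IsoHypReachNDLeavesP7 ↦ ¬ IsoHypReachNDLeavesP8` loses nothing.  Customer of record: Q47 (3 moves P · ℓ · Γ₀).  Engine: K5⁸ (separate file); rung: RUNG⁸.
-/

set_option linter.dupNamespace false
noncomputable section
open CategoryTheory CategoryTheory.Limits AlgebraicGeometry TopologicalSpace Topology IsLocalRing
open Literature.AlgebraicGeometry.Resolution
open AlgebraicGeometry.Scheme.IdealSheafData

namespace Summit.ResolutionOfSingularities.ResolutionOfSingularities.Cruxes.EquisingularLiftNat.Sections

/-- **`PrefixReachKeyLetterParam8 k n H ι Reach ReachL LS Open F' ρ' T'`** — Defs9's `PrefixReachKeyLetterParam7` with the hosted-round clause (HR-KEEP) REPLACED by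
(HR-KEEP-N) «NODAL hosted round that keeps its members» (desk R69): binder «`Z̃` regular» ↦ (N1) «finitely many non-regular points» and ONE added binder (N4) «a global
normal section that is a unit at the non-regular closed points»; clauses (0)(D)(Pc)(PL)(i)(O)(ii) and END byte-equal.  See the module docstring.
[OURS · L1 W4.5b · named predicate, no mathematical content of its own] -/
def PrefixReachKeyLetterParam8 (k : Type) [Field k] [IsAlgClosed k] (n : ℕ) (H : AlgebraicGeometry.Scheme.{0})
    (ι : H ⟶ (Literature.AlgebraicGeometry.Motives.projectiveSpace n k).left)
    (Reach : ∀ (F₁ F₂ : AlgebraicGeometry.Scheme.{0}), (F₂ ⟶ F₁) → F₁ → Set F₂ → ∀ (F₉ : AlgebraicGeometry.Scheme.{0}), (F₉ ⟶ F₂) → Set F₉ → Prop)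
    (ReachL : ∀ (F₂ : AlgebraicGeometry.Scheme.{0}), (F₂ ⟶ (Literature.AlgebraicGeometry.Motives.projectiveSpace n k).left) →
      (Literature.AlgebraicGeometry.Motives.projectiveSpace n k).left → Set F₂ → List (Set F₂) → ∀ (F₉ : AlgebraicGeometry.Scheme.{0}), (F₉ ⟶ F₂) → Set F₉ → Prop)
    (LS : ∀ (F₂ : AlgebraicGeometry.Scheme.{0}), (F₂ ⟶ (Literature.AlgebraicGeometry.Motives.projectiveSpace n k).left) →
      (Literature.AlgebraicGeometry.Motives.projectiveSpace n k).left → List (Set F₂) → Prop)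
    (Open : ∀ (F₃ : AlgebraicGeometry.Scheme.{0}), (F₃ ⟶ (Literature.AlgebraicGeometry.Motives.projectiveSpace n k).left) → Set F₃ → List (Set F₃) →
      Option (Set F₃ × Set F₃ × Set F₃) → Prop)
    (F' : AlgebraicGeometry.Scheme.{0}) (ρ' : F' ⟶ (Literature.AlgebraicGeometry.Motives.projectiveSpace n k).left) (T' : Set F') : Prop :=
  ∀ Q : (∀ F₁ : AlgebraicGeometry.Scheme.{0}, (F₁ ⟶ (Literature.AlgebraicGeometry.Motives.projectiveSpace n k).left) → Set F₁ → List (Set F₁) →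
      Option (Set F₁ × Set F₁ × Set F₁) → Prop),
    -- (0) START: no letters, no tag
    Q (Literature.AlgebraicGeometry.Motives.projectiveSpace n k).left (𝟙 (Literature.AlgebraicGeometry.Motives.projectiveSpace n k).left) (Set.range ι) [] none →
    -- (D) DROP: forget listed letters (any sublist, as a set of names) and/or the tag
    (∀ (F₁ : AlgebraicGeometry.Scheme.{0}) (ρ : F₁ ⟶ (Literature.AlgebraicGeometry.Motives.projectiveSpace n k).left) (T₁ : Set F₁) (Ls Ls' : List (Set F₁))
        (Kp Kp' : Option (Set F₁ × Set F₁ × Set F₁)),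
      Q F₁ ρ T₁ Ls Kp → (∀ L ∈ Ls', L ∈ Ls) → (Kp' = Kp ∨ Kp' = none) → Q F₁ ρ T₁ Ls' Kp') →
    -- (Pc) K5′'s POINT STEP + `Reach`-moves (PrefixReachBQuadPrime's first clause), from ANY slots, letters and tag DROPPED
    (∀ (F₁ F₂ : AlgebraicGeometry.Scheme.{0}) (ρ : F₁ ⟶ (Literature.AlgebraicGeometry.Motives.projectiveSpace n k).left) (T₁ : Set F₁) (Ls : List (Set F₁))
        (Kp : Option (Set F₁ × Set F₁ × Set F₁))
        (x : ↥(AlgebraicGeometry.Scheme.IdealSheafData.vanishingIdeal (⟨closure T₁, isClosed_closure⟩ : TopologicalSpace.Closeds F₁)).subscheme) (υ : F₂ ⟶ F₁)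
        (hx : IsClosed ({((AlgebraicGeometry.Scheme.IdealSheafData.vanishingIdeal
          (⟨closure T₁, isClosed_closure⟩ : TopologicalSpace.Closeds F₁)).subschemeι x : F₁)} : Set F₁)), Q F₁ ρ T₁ Ls Kp →
      ¬ IsRegularLocalRing ((AlgebraicGeometry.Scheme.IdealSheafData.vanishingIdeal
          (⟨closure T₁, isClosed_closure⟩ : TopologicalSpace.Closeds F₁)).subscheme.presheaf.stalk x) →
      IsRegularLocalRing (F₁.presheaf.stalk ((AlgebraicGeometry.Scheme.IdealSheafData.vanishingIdeal
          (⟨closure T₁, isClosed_closure⟩ : TopologicalSpace.Closeds F₁)).subschemeι x)) → Literature.AlgebraicGeometry.Resolution.IsBlowup υ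
        (AlgebraicGeometry.Scheme.IdealSheafData.vanishingIdeal (⟨{((AlgebraicGeometry.Scheme.IdealSheafData.vanishingIdeal
            (⟨closure T₁, isClosed_closure⟩ : TopologicalSpace.Closeds F₁)).subschemeι x : F₁)}, hx⟩ : TopologicalSpace.Closeds F₁)) →
      Q F₂ (υ ≫ ρ) (closure (υ ⁻¹' (T₁ \ {((AlgebraicGeometry.Scheme.IdealSheafData.vanishingIdeal
          (⟨closure T₁, isClosed_closure⟩ : TopologicalSpace.Closeds F₁)).subschemeι x : F₁)}))) [] none ∧ (∀ (F₉ : AlgebraicGeometry.Scheme.{0}) (β : F₉ ⟶ F₂) (T₉ : Set F₉),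
        Reach F₁ F₂ υ ((AlgebraicGeometry.Scheme.IdealSheafData.vanishingIdeal (⟨closure T₁, isClosed_closure⟩ : TopologicalSpace.Closeds F₁)).subschemeι x)
          (closure (υ ⁻¹' (T₁ \ {((AlgebraicGeometry.Scheme.IdealSheafData.vanishingIdeal
            (⟨closure T₁, isClosed_closure⟩ : TopologicalSpace.Closeds F₁)).subschemeι x : F₁)}))) F₉ β T₉ → Q F₉ ((β ≫ υ) ≫ ρ) T₉ [] none)) →
    -- (PL) A⁗: at the INITIAL stage only, LETTERED `ReachL`-towers after a good point step (PrefixReachBQuadPrime's second clause), conclusion at `[] none`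
    (∀ (F₂ : AlgebraicGeometry.Scheme.{0}) (x₀ : ↥(AlgebraicGeometry.Scheme.IdealSheafData.vanishingIdeal
          (⟨closure (Set.range ι), isClosed_closure⟩ : TopologicalSpace.Closeds (Literature.AlgebraicGeometry.Motives.projectiveSpace n k).left)).subscheme)
        (υ : F₂ ⟶ (Literature.AlgebraicGeometry.Motives.projectiveSpace n k).left) (hx₀ : IsClosed ({((AlgebraicGeometry.Scheme.IdealSheafData.vanishingIdeal
          (⟨closure (Set.range ι), isClosed_closure⟩ : TopologicalSpace.Closeds (Literature.AlgebraicGeometry.Motives.projectiveSpace n k).left)).subschemeι x₀ : (Literature.AlgebraicGeometry.Motives.projectiveSpace n k).left)} : Set (Literature.AlgebraicGeometry.Motives.projectiveSpace n k).left))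
        (Ls₂ : List (Set F₂)), ¬ IsRegularLocalRing ((AlgebraicGeometry.Scheme.IdealSheafData.vanishingIdeal
          (⟨closure (Set.range ι), isClosed_closure⟩ : TopologicalSpace.Closeds (Literature.AlgebraicGeometry.Motives.projectiveSpace n k).left)).subscheme.presheaf.stalk x₀) →
      IsRegularLocalRing ((Literature.AlgebraicGeometry.Motives.projectiveSpace n k).left.presheaf.stalk ((AlgebraicGeometry.Scheme.IdealSheafData.vanishingIdeal
          (⟨closure (Set.range ι), isClosed_closure⟩ : TopologicalSpace.Closeds (Literature.AlgebraicGeometry.Motives.projectiveSpace n k).left)).subschemeι x₀ : (Literature.AlgebraicGeometry.Motives.projectiveSpace n k).left)) →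
      Literature.AlgebraicGeometry.Resolution.IsBlowup υ (AlgebraicGeometry.Scheme.IdealSheafData.vanishingIdeal (⟨{((AlgebraicGeometry.Scheme.IdealSheafData.vanishingIdeal
          (⟨closure (Set.range ι), isClosed_closure⟩ : TopologicalSpace.Closeds (Literature.AlgebraicGeometry.Motives.projectiveSpace n k).left)).subschemeι x₀ : (Literature.AlgebraicGeometry.Motives.projectiveSpace n k).left)}, hx₀⟩ : TopologicalSpace.Closeds (Literature.AlgebraicGeometry.Motives.projectiveSpace n k).left)) →
      LS F₂ υ ((AlgebraicGeometry.Scheme.IdealSheafData.vanishingIdeal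
          (⟨closure (Set.range ι), isClosed_closure⟩ : TopologicalSpace.Closeds (Literature.AlgebraicGeometry.Motives.projectiveSpace n k).left)).subschemeι x₀ : (Literature.AlgebraicGeometry.Motives.projectiveSpace n k).left) Ls₂ →
      ∀ (F₉ : AlgebraicGeometry.Scheme.{0}) (β : F₉ ⟶ F₂) (T₉ : Set F₉), ReachL F₂ υ ((AlgebraicGeometry.Scheme.IdealSheafData.vanishingIdeal
          (⟨closure (Set.range ι), isClosed_closure⟩ : TopologicalSpace.Closeds (Literature.AlgebraicGeometry.Motives.projectiveSpace n k).left)).subschemeι x₀ : (Literature.AlgebraicGeometry.Motives.projectiveSpace n k).left) (closure (υ ⁻¹' (Set.range ι \ {((AlgebraicGeometry.Scheme.IdealSheafData.vanishingIdeal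
          (⟨closure (Set.range ι), isClosed_closure⟩ : TopologicalSpace.Closeds (Literature.AlgebraicGeometry.Motives.projectiveSpace n k).left)).subschemeι x₀ : (Literature.AlgebraicGeometry.Motives.projectiveSpace n k).left)}))) Ls₂ F₉ β T₉ →
        Q F₉ (β ≫ υ) T₉ [] none) →
    -- (i) LETTERED POINT STEP at a closed non-regular point of `T̃`, regular on `F`: at most ONE listed letter THROUGH the point (`Lt = some L`: nested section,
    --     `L̃` regular at the point), every other listed letter AWAY, the tag's three letters AWAY; letters `↦ St`, tag `↦ St`, optional birth of `E_x = υ⁻¹{x}`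
    (∀ (F₁ F₂ : AlgebraicGeometry.Scheme.{0}) (ρ : F₁ ⟶ (Literature.AlgebraicGeometry.Motives.projectiveSpace n k).left) (T₁ : Set F₁) (Ls : List (Set F₁))
        (Kp : Option (Set F₁ × Set F₁ × Set F₁)) (Lt : Option (Set F₁))
        (x : ↥(AlgebraicGeometry.Scheme.IdealSheafData.vanishingIdeal (⟨closure T₁, isClosed_closure⟩ : TopologicalSpace.Closeds F₁)).subscheme) (υ : F₂ ⟶ F₁)
        (hx : IsClosed ({((AlgebraicGeometry.Scheme.IdealSheafData.vanishingIdeal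
          (⟨closure T₁, isClosed_closure⟩ : TopologicalSpace.Closeds F₁)).subschemeι x : F₁)} : Set F₁)), Q F₁ ρ T₁ Ls Kp →
      ¬ IsRegularLocalRing ((AlgebraicGeometry.Scheme.IdealSheafData.vanishingIdeal
          (⟨closure T₁, isClosed_closure⟩ : TopologicalSpace.Closeds F₁)).subscheme.presheaf.stalk x) →
      IsRegularLocalRing (F₁.presheaf.stalk ((AlgebraicGeometry.Scheme.IdealSheafData.vanishingIdeal
          (⟨closure T₁, isClosed_closure⟩ : TopologicalSpace.Closeds F₁)).subschemeι x)) →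
      (∀ L ∈ Ls, ((AlgebraicGeometry.Scheme.IdealSheafData.vanishingIdeal (⟨closure T₁, isClosed_closure⟩ : TopologicalSpace.Closeds F₁)).subschemeι x : F₁) ∈ closure L →
        Lt = some L) →
      (∀ L : Set F₁, Lt = some L → L ∈ Ls ∧ ∀ e : ↥(redSub F₁ (closure L) isClosed_closure), (redSubι F₁ (closure L) isClosed_closure e : F₁) =
          ((AlgebraicGeometry.Scheme.IdealSheafData.vanishingIdeal (⟨closure T₁, isClosed_closure⟩ : TopologicalSpace.Closeds F₁)).subschemeι x : F₁) →
        IsRegularLocalRing ((redSub F₁ (closure L) isClosed_closure).presheaf.stalk e)) →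
      (∀ K A C : Set F₁, Kp = some (K, A, C) →
        ((AlgebraicGeometry.Scheme.IdealSheafData.vanishingIdeal (⟨closure T₁, isClosed_closure⟩ : TopologicalSpace.Closeds F₁)).subschemeι x : F₁) ∉ closure K ∧
        ((AlgebraicGeometry.Scheme.IdealSheafData.vanishingIdeal (⟨closure T₁, isClosed_closure⟩ : TopologicalSpace.Closeds F₁)).subschemeι x : F₁) ∉ closure A ∧
        ((AlgebraicGeometry.Scheme.IdealSheafData.vanishingIdeal (⟨closure T₁, isClosed_closure⟩ : TopologicalSpace.Closeds F₁)).subschemeι x : F₁) ∉ closure C) →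
      Literature.AlgebraicGeometry.Resolution.IsBlowup υ
        (AlgebraicGeometry.Scheme.IdealSheafData.vanishingIdeal (⟨{((AlgebraicGeometry.Scheme.IdealSheafData.vanishingIdeal
            (⟨closure T₁, isClosed_closure⟩ : TopologicalSpace.Closeds F₁)).subschemeι x : F₁)}, hx⟩ : TopologicalSpace.Closeds F₁)) →
      ∀ Ls' : List (Set F₂),
        (Ls' = Ls.map (fun L => closure (υ ⁻¹' (L \ {((AlgebraicGeometry.Scheme.IdealSheafData.vanishingIdeal
            (⟨closure T₁, isClosed_closure⟩ : TopologicalSpace.Closeds F₁)).subschemeι x : F₁)}))) ∨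
         Ls' = Ls.map (fun L => closure (υ ⁻¹' (L \ {((AlgebraicGeometry.Scheme.IdealSheafData.vanishingIdeal
            (⟨closure T₁, isClosed_closure⟩ : TopologicalSpace.Closeds F₁)).subschemeι x : F₁)}))) ++
            [υ ⁻¹' {((AlgebraicGeometry.Scheme.IdealSheafData.vanishingIdeal (⟨closure T₁, isClosed_closure⟩ : TopologicalSpace.Closeds F₁)).subschemeι x : F₁)}]) →
        Q F₂ (υ ≫ ρ) (closure (υ ⁻¹' (T₁ \ {((AlgebraicGeometry.Scheme.IdealSheafData.vanishingIdeal
            (⟨closure T₁, isClosed_closure⟩ : TopologicalSpace.Closeds F₁)).subschemeι x : F₁)}))) Ls'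
          (Kp.map (fun t => (closure (υ ⁻¹' (t.1 \ {((AlgebraicGeometry.Scheme.IdealSheafData.vanishingIdeal
              (⟨closure T₁, isClosed_closure⟩ : TopologicalSpace.Closeds F₁)).subschemeι x : F₁)})),
            closure (υ ⁻¹' (t.2.1 \ {((AlgebraicGeometry.Scheme.IdealSheafData.vanishingIdeal
              (⟨closure T₁, isClosed_closure⟩ : TopologicalSpace.Closeds F₁)).subschemeι x : F₁)})),
            closure (υ ⁻¹' (t.2.2 \ {((AlgebraicGeometry.Scheme.IdealSheafData.vanishingIdeal
              (⟨closure T₁, isClosed_closure⟩ : TopologicalSpace.Closeds F₁)).subschemeι x : F₁)})))))) →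
    -- (O) CERTIFIED OPENING (opaque here; Defs8: `Open := OpeningCert k n H ι`, S10's «birth of M♮ + P(x₀) + CAR + PROMOTE» certificate list, text v1.1)
    (∀ (F₃ : AlgebraicGeometry.Scheme.{0}) (ρ₃ : F₃ ⟶ (Literature.AlgebraicGeometry.Motives.projectiveSpace n k).left) (T₃ : Set F₃) (Ls₃ : List (Set F₃))
        (Kp₃ : Option (Set F₃ × Set F₃ × Set F₃)), Open F₃ ρ₃ T₃ Ls₃ Kp₃ → Q F₃ ρ₃ T₃ Ls₃ Kp₃) →
    -- (ii) PAIR ROUND at the transversal crossing curve `Z` of two listed letters `A ≠ B` (stage-level, (T-k)-free): `Z ⊆ T`, `T ⊄ Z`, `Z̃` regular, curve clause,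
    --      `F` regular at the closed points of `Z`; the tag is absent or HOSTS (its pair is `{A, B}`, its key letter is listed and is not a member); every other
    --      listed letter does not contain `Z` and meets it transversally (possibly not at all); letters `↦ St`, tag consumed, optional birth of `E_Z = υ'⁻¹ Z`
    (∀ (F₁ F₃ : AlgebraicGeometry.Scheme.{0}) (ρ : F₁ ⟶ (Literature.AlgebraicGeometry.Motives.projectiveSpace n k).left) (T₁ : Set F₁) (Ls : List (Set F₁))
        (Kp : Option (Set F₁ × Set F₁ × Set F₁)) (A B Z : Set F₁) (hZ : IsClosed Z) (υ' : F₃ ⟶ F₁),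
      Q F₁ ρ T₁ Ls Kp → A ∈ Ls → B ∈ Ls → A ≠ B →
      AlgebraicGeometry.Scheme.IdealSheafData.vanishingIdeal (⟨closure A, isClosed_closure⟩ : TopologicalSpace.Closeds F₁) ⊔
          AlgebraicGeometry.Scheme.IdealSheafData.vanishingIdeal (⟨closure B, isClosed_closure⟩ : TopologicalSpace.Closeds F₁) =
        AlgebraicGeometry.Scheme.IdealSheafData.vanishingIdeal (⟨Z, hZ⟩ : TopologicalSpace.Closeds F₁) →
      Z ⊆ T₁ → ¬ T₁ ⊆ Z → (∀ z : ↥(redSub F₁ Z hZ), IsRegularLocalRing ((redSub F₁ Z hZ).presheaf.stalk z)) →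
      (∀ z : ↥(redSub F₁ Z hZ), IsClosed ({z} : Set ↥(redSub F₁ Z hZ)) → ringKrullDim ((redSub F₁ Z hZ).presheaf.stalk z) = ((1 : ℕ) : WithBot ℕ∞)) →
      (∀ z ∈ Z, IsClosed ({z} : Set F₁) → IsRegularLocalRing (F₁.presheaf.stalk z)) →
      (∀ K A' C' : Set F₁, Kp = some (K, A', C') → K ∈ Ls ∧ K ≠ A ∧ K ≠ B ∧ ((A' = A ∧ C' = B) ∨ (A' = B ∧ C' = A))) →
      (∀ L ∈ Ls, L ≠ A → L ≠ B → (∀ K A' C' : Set F₁, Kp = some (K, A', C') → L ≠ K) →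
        AlgebraicGeometry.Scheme.IdealSheafData.vanishingIdeal (⟨closure L, isClosed_closure⟩ : TopologicalSpace.Closeds F₁) ⊔
            AlgebraicGeometry.Scheme.IdealSheafData.vanishingIdeal (⟨Z, hZ⟩ : TopologicalSpace.Closeds F₁) =
          AlgebraicGeometry.Scheme.IdealSheafData.vanishingIdeal (⟨closure L ∩ Z, isClosed_closure.inter hZ⟩ : TopologicalSpace.Closeds F₁) ∧
        ∀ z ∈ Z, IsClosed ({z} : Set F₁) →
          ¬ Literature.AlgebraicGeometry.Resolution.stalkIdeal (AlgebraicGeometry.Scheme.IdealSheafData.vanishingIdeal (⟨closure L, isClosed_closure⟩ : TopologicalSpace.Closeds F₁)) z ≤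
            Literature.AlgebraicGeometry.Resolution.stalkIdeal (AlgebraicGeometry.Scheme.IdealSheafData.vanishingIdeal (⟨Z, hZ⟩ : TopologicalSpace.Closeds F₁)) z) →
      Literature.AlgebraicGeometry.Resolution.IsBlowup υ' (AlgebraicGeometry.Scheme.IdealSheafData.vanishingIdeal (⟨Z, hZ⟩ : TopologicalSpace.Closeds F₁)) →
      ∀ Ls' : List (Set F₃),
        (Ls' = Ls.map (fun L => closure (υ' ⁻¹' (closure L \ Z))) ∨ Ls' = Ls.map (fun L => closure (υ' ⁻¹' (closure L \ Z))) ++ [υ' ⁻¹' Z]) →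
        Q F₃ (υ' ≫ ρ) (closure (υ' ⁻¹' (T₁ \ Z))) Ls' none) →
    -- (HR-KEEP-N) NODAL HOSTED ROUND inside a listed host `E₁ ∈ Ls` THAT KEEPS ITS MEMBERS (WIDTH TABLE D8, desk R69; replaces Defs9's (HR-KEEP)): the (HR-KEEP)
    --      antecedents VERBATIM EXCEPT binder 5 «`Z̃` regular», which becomes (N1) «`Z̃` has FINITELY MANY non-regular points» (the tower carrier round's own
    --      wording), and ONE added binder (N4) «a global section of the normal sheaf `𝒩_{Z̃/Ẽ₁}` that is a unit at every non-regular closed point of `Z̃`»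
    --      placed after (N3) = `DirStepUnobs`; (N2) «`Ẽ₁` regular along `Z̃`» (so every singularity of `Z̃` is planar) and (N3) are byte-identical; curve clause,
    --      members block, blow-up and the ONE output (every listed letter `↦ St`, BIRTH of `E_Z = υ'⁻¹ Z`, tag dropped) byte-identical; supplier = ✓ `TCPlus.hround_keep`
    --      on the regular `O`-flat lift of `Z̃` (support debt S-D8-LIFT)
    (∀ (F₁ F₃ : AlgebraicGeometry.Scheme.{0}) (ρ : F₁ ⟶ (Literature.AlgebraicGeometry.Motives.projectiveSpace n k).left) (T₁ : Set F₁) (Ls : List (Set F₁))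
        (Kp : Option (Set F₁ × Set F₁ × Set F₁)) (E₁ : Set F₁) (Z : Set F₁) (hZ : IsClosed Z) (υ' : F₃ ⟶ F₁),
      Q F₁ ρ T₁ Ls Kp → E₁ ∈ Ls → Z ⊆ closure E₁ → Z ⊆ T₁ → ¬ T₁ ⊆ Z →
      Set.Finite {z : ↥(redSub F₁ Z hZ) | ¬ IsRegularLocalRing ((redSub F₁ Z hZ).presheaf.stalk z)} →
      (∀ (i : redSub F₁ Z hZ ⟶ redSub F₁ (closure E₁) isClosed_closure), i ≫ redSubι F₁ (closure E₁) isClosed_closure = redSubι F₁ Z hZ →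
        ∀ z : ↥(redSub F₁ Z hZ), IsRegularLocalRing ((redSub F₁ (closure E₁) isClosed_closure).presheaf.stalk (i z))) → DirStepUnobs F₁ (closure E₁) isClosed_closure Z hZ →
      (∀ (i : redSub F₁ Z hZ ⟶ redSub F₁ (closure E₁) isClosed_closure), i ≫ redSubι F₁ (closure E₁) isClosed_closure = redSubι F₁ Z hZ →
        ∃ ψ : Γ(Literature.AlgebraicGeometry.HodgeTheory.normalSheaf i, ⊤),
          ∀ z : ↥(redSub F₁ Z hZ), IsClosed ({z} : Set ↥(redSub F₁ Z hZ)) → ¬ IsRegularLocalRing ((redSub F₁ Z hZ).presheaf.stalk z) →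
            ∃ (U : (redSub F₁ (closure E₁) isClosed_closure).affineOpens) (hz : z ∈ i ⁻¹ᵁ (U : (redSub F₁ (closure E₁) isClosed_closure).Opens))
              (m : Γ(Literature.AlgebraicGeometry.Deformation.idealModule i, (U : (redSub F₁ (closure E₁) isClosed_closure).Opens))),
              IsUnit ((redSub F₁ Z hZ).presheaf.germ (i ⁻¹ᵁ (U : (redSub F₁ (closure E₁) isClosed_closure).Opens)) z hz
                (Literature.AlgebraicGeometry.HodgeTheory.normalSectionsVal i U
                  (Literature.AlgebraicGeometry.HodgeTheory.normalSheafSectionsEquiv i _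
                    ((Literature.AlgebraicGeometry.HodgeTheory.normalSheaf i).presheaf.map (homOfLE le_top).op ψ)) m))) →
      (∀ z : ↥(redSub F₁ Z hZ), IsClosed ({z} : Set ↥(redSub F₁ Z hZ)) → ringKrullDim ((redSub F₁ Z hZ).presheaf.stalk z) = ((1 : ℕ) : WithBot ℕ∞)) →
      (∀ L ∈ Ls, L ≠ E₁ →
        AlgebraicGeometry.Scheme.IdealSheafData.vanishingIdeal (⟨closure L, isClosed_closure⟩ : TopologicalSpace.Closeds F₁) ⊔
            AlgebraicGeometry.Scheme.IdealSheafData.vanishingIdeal (⟨Z, hZ⟩ : TopologicalSpace.Closeds F₁) =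
          AlgebraicGeometry.Scheme.IdealSheafData.vanishingIdeal (⟨closure L ∩ Z, isClosed_closure.inter hZ⟩ : TopologicalSpace.Closeds F₁) ∧
        ∀ z ∈ Z, IsClosed ({z} : Set F₁) →
          ¬ Literature.AlgebraicGeometry.Resolution.stalkIdeal (AlgebraicGeometry.Scheme.IdealSheafData.vanishingIdeal (⟨closure L, isClosed_closure⟩ : TopologicalSpace.Closeds F₁)) z ≤
            Literature.AlgebraicGeometry.Resolution.stalkIdeal (AlgebraicGeometry.Scheme.IdealSheafData.vanishingIdeal (⟨Z, hZ⟩ : TopologicalSpace.Closeds F₁)) z) →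
      Literature.AlgebraicGeometry.Resolution.IsBlowup υ' (AlgebraicGeometry.Scheme.IdealSheafData.vanishingIdeal (⟨Z, hZ⟩ : TopologicalSpace.Closeds F₁)) →
      Q F₃ (υ' ≫ ρ) (closure (υ' ⁻¹' (T₁ \ Z))) (Ls.map (fun L => closure (υ' ⁻¹' (closure L \ Z))) ++ [υ' ⁻¹' Z]) none) →
    -- END (C3): the final slots are existential
    ∃ (Ls : List (Set F')) (Kp : Option (Set F' × Set F' × Set F')), Q F' ρ' T' Ls Kp


/-- **`PrefixReachKeyLetterP8 k n H ι F' ρ' T'`** — the NODAL-HOSTED-ROUND PREFIX REACH: `PrefixReachKeyLetterParam8` at the same four slots as `PrefixReachKeyLetterP7`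
(`Reach := ReachTowerBTriplePrime`, `ReachL := ReachTowerBQuintPrime ℙⁿ`, `LS := HyperplaneLetters`, `Open := OpeningCertKeyLetter`). [OURS · named predicate] -/
def PrefixReachKeyLetterP8 (k : Type) [Field k] [IsAlgClosed k] (n : ℕ) (H : AlgebraicGeometry.Scheme.{0})
    (ι : H ⟶ (Literature.AlgebraicGeometry.Motives.projectiveSpace n k).left) (F' : AlgebraicGeometry.Scheme.{0}) (ρ' : F' ⟶ (Literature.AlgebraicGeometry.Motives.projectiveSpace n k).left) (T' : Set F') : Prop :=
  PrefixReachKeyLetterParam8 k n H ι ReachTowerBTriplePrime (ReachTowerBQuintPrime (Literature.AlgebraicGeometry.Motives.projectiveSpace n k).left) (HyperplaneLetters k n H ι) (OpeningCertKeyLetter k n H ι) F' ρ' T'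

/-- **`IsoHypReachNDLeavesP8 k n H ι`** — «a NODAL-HOSTED-ROUND prefix ends at a stage with (pointwise) ND LEAVES»: (K6-1P) over `PrefixReachKeyLetterP8`.
[OURS · L1 W4.5b · named hypothesis, no mathematical content of its own] -/
def IsoHypReachNDLeavesP8 (k : Type) [Field k] [IsAlgClosed k] (n : ℕ) (H : AlgebraicGeometry.Scheme.{0})
    (ι : H ⟶ (Literature.AlgebraicGeometry.Motives.projectiveSpace n k).left) : Prop :=
  ∃ (F : AlgebraicGeometry.Scheme.{0}) (ρ : F ⟶ (Literature.AlgebraicGeometry.Motives.projectiveSpace n k).left) (T : Set F) (m : ℕ),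
    PrefixReachKeyLetterP8 k n H ι F ρ T ∧ ND.NDInvCLNP n k m F ρ T

/-- **Prefix⁷ ⊆ prefix⁸ (parametric)**: a motive closed under the P8 clauses is closed under Defs9's (HR-KEEP) — with `Z̃` regular the non-regular set is empty
((N1) by `Set.finite_empty`) and (N4) holds with `ψ := 0` vacuously; every other clause is passed through unchanged. [OURS · pure logic] -/
theorem prefixReachKeyLetterParam8_of_param7 (k : Type) [Field k] [IsAlgClosed k] (n : ℕ) (H : AlgebraicGeometry.Scheme.{0})
    (ι : H ⟶ (Literature.AlgebraicGeometry.Motives.projectiveSpace n k).left)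
    (Reach : ∀ (F₁ F₂ : AlgebraicGeometry.Scheme.{0}), (F₂ ⟶ F₁) → F₁ → Set F₂ → ∀ (F₉ : AlgebraicGeometry.Scheme.{0}), (F₉ ⟶ F₂) → Set F₉ → Prop)
    (ReachL : ∀ (F₂ : AlgebraicGeometry.Scheme.{0}), (F₂ ⟶ (Literature.AlgebraicGeometry.Motives.projectiveSpace n k).left) →
      (Literature.AlgebraicGeometry.Motives.projectiveSpace n k).left → Set F₂ → List (Set F₂) → ∀ (F₉ : AlgebraicGeometry.Scheme.{0}), (F₉ ⟶ F₂) → Set F₉ → Prop)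
    (LS : ∀ (F₂ : AlgebraicGeometry.Scheme.{0}), (F₂ ⟶ (Literature.AlgebraicGeometry.Motives.projectiveSpace n k).left) →
      (Literature.AlgebraicGeometry.Motives.projectiveSpace n k).left → List (Set F₂) → Prop)
    (Open : ∀ (F₃ : AlgebraicGeometry.Scheme.{0}), (F₃ ⟶ (Literature.AlgebraicGeometry.Motives.projectiveSpace n k).left) → Set F₃ → List (Set F₃) →
      Option (Set F₃ × Set F₃ × Set F₃) → Prop)
    (F' : AlgebraicGeometry.Scheme.{0}) (ρ' : F' ⟶ (Literature.AlgebraicGeometry.Motives.projectiveSpace n k).left) (T' : Set F')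
    (h : PrefixReachKeyLetterParam7 k n H ι Reach ReachL LS Open F' ρ' T') : PrefixReachKeyLetterParam8 k n H ι Reach ReachL LS Open F' ρ' T' := by
  intro Q h0 hD hPc hPL hi hO hii hHRKN
  refine h Q h0 hD hPc hPL hi hO hii ?_
  intro F₁ F₃ ρ T₁ Ls Kp E₁ Z hZ υ' hQ hE₁ hZE hZT hTZ hZreg hEreg hunobs hZdim hOthers hυ'
  exact hHRKN F₁ F₃ ρ T₁ Ls Kp E₁ Z hZ υ' hQ hE₁ hZE hZT hTZ (Set.finite_empty.subset fun z hz => (hz (hZreg z)).elim) hEreg hunobs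
    (fun i _ => ⟨0, fun z _ hz => (hz (hZreg z)).elim⟩) hZdim hOthers hυ'

/-- **Prefix⁷ ⊆ prefix⁸** at the four slots of record. [OURS · pure logic] -/
theorem prefixReachKeyLetterP8_of_P7 (k : Type) [Field k] [IsAlgClosed k] (n : ℕ) (H : AlgebraicGeometry.Scheme.{0})
    (ι : H ⟶ (Literature.AlgebraicGeometry.Motives.projectiveSpace n k).left) (F' : AlgebraicGeometry.Scheme.{0}) (ρ' : F' ⟶ (Literature.AlgebraicGeometry.Motives.projectiveSpace n k).left) (T' : Set F')
    (h : PrefixReachKeyLetterP7 k n H ι F' ρ' T') : PrefixReachKeyLetterP8 k n H ι F' ρ' T' :=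
  prefixReachKeyLetterParam8_of_param7 k n H ι _ _ _ _ F' ρ' T' h

/-- ★ **Inclusion P7 ⊆ P8** (the REPLACE cut `¬ IsoHypReachNDLeavesP7 ↦ ¬ IsoHypReachNDLeavesP8` loses nothing). [OURS · pure logic] -/
theorem isoHypReachNDLeavesP8_of_P7 (k : Type) [Field k] [IsAlgClosed k] (n : ℕ) (H : AlgebraicGeometry.Scheme.{0})
    (ι : H ⟶ (Literature.AlgebraicGeometry.Motives.projectiveSpace n k).left) (h : IsoHypReachNDLeavesP7 k n H ι) : IsoHypReachNDLeavesP8 k n H ι := by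
  obtain ⟨F, ρ, T, m, hpre, hND⟩ := h
  exact ⟨F, ρ, T, m, prefixReachKeyLetterP8_of_P7 k n H ι F ρ T hpre, hND⟩

/-- **Inclusion P6 ⊆ P8** (via ✓ `isoHypReachNDLeavesP7_of_P6`). [OURS · pure logic] -/
theorem isoHypReachNDLeavesP8_of_P6 (k : Type) [Field k] [IsAlgClosed k] (n : ℕ) (H : AlgebraicGeometry.Scheme.{0})
    (ι : H ⟶ (Literature.AlgebraicGeometry.Motives.projectiveSpace n k).left) (h : IsoHypReachNDLeavesP6 k n H ι) : IsoHypReachNDLeavesP8 k n H ι :=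
  isoHypReachNDLeavesP8_of_P7 k n H ι (isoHypReachNDLeavesP7_of_P6 k n H ι h)

/-- **Inclusion P5 ⊆ P8** (via ✓ `isoHypReachNDLeavesP7_of_P5`). [OURS · pure logic] -/
theorem isoHypReachNDLeavesP8_of_P5 (k : Type) [Field k] [IsAlgClosed k] (n : ℕ) (H : AlgebraicGeometry.Scheme.{0})
    (ι : H ⟶ (Literature.AlgebraicGeometry.Motives.projectiveSpace n k).left) (h : IsoHypReachNDLeavesP5 k n H ι) : IsoHypReachNDLeavesP8 k n H ι :=
  isoHypReachNDLeavesP8_of_P7 k n H ι (isoHypReachNDLeavesP7_of_P5 k n H ι h)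

/-- **Inclusion P ⊆ P8** (via ✓ `isoHypReachNDLeavesP7_of_P`). [OURS · pure logic] -/
theorem isoHypReachNDLeavesP8_of_P (k : Type) [Field k] [IsAlgClosed k] (n : ℕ) (H : AlgebraicGeometry.Scheme.{0})
    (ι : H ⟶ (Literature.AlgebraicGeometry.Motives.projectiveSpace n k).left) (h : IsoHypReachNDLeavesP k n H ι) : IsoHypReachNDLeavesP8 k n H ι :=
  isoHypReachNDLeavesP8_of_P7 k n H ι (isoHypReachNDLeavesP7_of_P k n H ι h)

/-- Contrapositive form, as the REPLACE cut consumes it (the REGISTERED hypothesis of `stub_elnat_three_isolated_nonNDLeaves7` is `¬ IsoHypReachNDLeavesP7`).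
[OURS · pure logic] -/
theorem not_isoHypReachNDLeavesP7_of_not_P8 (k : Type) [Field k] [IsAlgClosed k] (n : ℕ) (H : AlgebraicGeometry.Scheme.{0})
    (ι : H ⟶ (Literature.AlgebraicGeometry.Motives.projectiveSpace n k).left) (h : ¬ IsoHypReachNDLeavesP8 k n H ι) : ¬ IsoHypReachNDLeavesP7 k n H ι :=
  fun h' => h (isoHypReachNDLeavesP8_of_P7 k n H ι h')

end Summit.ResolutionOfSingularities.ResolutionOfSingularities.Cruxes.EquisingularLiftNat.Sections

end
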